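import Summits.QuantumFields.BalabanUV.Beta.GAN24.CombQuarticContactChargeZero
import Summits.QuantumFields.BalabanUV.Beta.GAN24.T2SlotUnits

/-!
# `BalabanUV.Beta.GAN24.CombChargeParityOddOfQuarticLaw` — binder row G-an2-4 ∕ (CONV-C), W-slot, row (C) at levels ≥ 1, THE PARITY ROUTE ASSEMBLED MODULO ONE LETTER:
# **GIVEN an2's QUARTIC REFLECTION LAW OF THE COMB TOWER AT LEVEL `j` (its TABLE-level form, canonical contact, row-parity-odd remainder — WANTED W-an2-1), THE
# MEMBER's ff CHARGE IS LEG-ANTISYMMETRIC ON EVERY PATTERN WITH AN ODD AXIS — SO ITS LEG-SYMMETRISED (C) ROW VANISHES THERE WITHOUT ANY VALUATION**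
# (road-P2 chair of row G-an2-4, unit `b2b-balaban-gan24-p2` gen 48, crux team (2))

NOT IN PRINT; OUR BOOKKEEPING ([folklore] three additions of charges BY NAME; 0 `def`, 0 cited facts, 0 `def … : Prop`, 0 sorry).  HONEST FRAMING (cell contract, verbatim):
«discharging `BetaPertH` makes Bałaban's UV stability UNCONDITIONAL — a real constructive-QFT result; it is NOT the continuum limit and NOT the Clay problem.»  HONEST DEPENDENCY
(verbatim): «continuum YM on T⁴ ⇐ BetaPertH ∧ nine spine estimates (0/9 proved); BetaPertH ⇐ (D1) ∧ (D4) ∧ CAP+tail; G-an2-4 gates asym, D1 and NE2/3/4.»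

WHAT.
* §1 (generic `d`, any `N`) **`zmode_add_legSwap_eq_zero_of_refl_add`**: a jointly covariant `LocStencil₂` family `T` obeying the axis-`α` reflection law with a `LocStencil₂` defect
  `J` whose ff charge is LEG-ANTISYMMETRIC has leg-antisymmetric ff charge on every pattern in which `α` occurs an odd number of times: `zmode N T κκ′(κ₁κ₂) + zmode N T κκ′(κ₂κ₁) = 0`
  (g47 `ZeroModeReflectionParity.two_mul_zmode_eq_neg_of_reflSign_prod` twice + `WSlotFirstDiff.zmode_add`).  `legAntisym_of_split`: a defect `J = J^W + R` with `zmode J^W = 0`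
  (both leg orders) and `R` row-parity-odd is such a defect (g47 §3).
* §2 (the comb tower, `d + 1 = 4`, odd `Lc`, centred root, pin `(cE, cVH) = (Lc⁴, −Lc⁸∕2)`, ANY `cΛ cE₂ cB`, colour table `T`, border ∕ mixed tables with their classes and block
  covariance) **`zmode_T2RecAt_add_legSwap_eq_zero_of_law`**: IF at level `j` the quartic table obeys, for every axis `α`,
  `T2RecAt … j κ (bref α κ u) κ′ (bref α κ′ u′) = (ε_κ ε_κ′) • refK (Φ Lc α) (T2RecAt … j κ u κ′ u′ + conjW 𝕄_j (S_j κ u) (S_j κ′ u′) (diagK (γ·ctGen α κ u)) (diagK (γ·ctGen α κ′ u′))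
  (diagK (γ₂·ctGen α κ u·ctGen α κ′ u′)) + R2 α κ u κ′ u′)` with `R2 α` a row-parity-odd `LocStencil₂` family (THE SHAPE OF an2's `SpineRecursiveT2All.T2RecAt_bref_all_of_letters` ∕
  `…Canon` at level `j`, `γ = γ_j`, `γ₂ = γ_j²`), THEN for every pattern `(κ, κ′; κ₁, κ₂)` with an axis of odd multiplicity
  `zmode Lc (T2RecAt … j) κ κ′ (inl κ₁) (inl κ₂) + zmode Lc (T2RecAt … j) κ κ′ (inl κ₂) (inl κ₁) = 0` — the contact defect carries no charge (`CombQuarticContactChargeZero`), the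
  remainder is leg-antisymmetric (g47 §3).  §3 `…_unitS₂_…`: the same for the member in step units `unitS₂ sf sm (T2RecAt … j)` (the ff block only rescales).
WHY (located, zero weight): MY (D) `WrecAtEvenHalfRowsOfQLCSymLeg` §3 asks the literal's (C) display as `hZ₂` = equality of the LEG-SUMMED bond-symmetrised charges of consecutive
members at levels ≥ 1; on the 216 (of 256, `d = 3`) patterns with an odd axis BOTH sides are `0` by §3 once W-an2-1 supplies the law at the literal's tables — no exchange ∕ contact
valuation; the (TL) programme (leaf-06 ∕ leaf-02 ∕ leaf-04 ∕ an2) then owes the two-pair class (36) and the all-equal class (4) only.  THE LAW IS A HYPOTHESIS HERE (`hlaw`);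
discharges NOTHING of (C)_{≥1} ∕ (Q-L) ∕ (H1♮) by itself; (β) of record untouched; NEVER «G-an2-4 closed» as (CONV-C); NOT D1, NOT `BetaPertH`, NOT continuum, NOT Clay.
2026-08-23; no existing file touched.
-/

noncomputable section

open Finset
open scoped BigOperators
open Literature.MathematicalPhysics.QuantumFieldTheory
open Literature.MathematicalPhysics.QuantumFieldTheory.Balaban1983to89
open Literature.MathematicalPhysics.QuantumFieldTheory.Balaban1983to89.Beta
open ExpKernelCalculus (MKer shiftK BiLoc Decays)
open OneStepResolventKernel (Fib LocStencil)
open BalabanStepJets (locStencil_mono)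
open OneStepResolventKernel (decays_mono)
open AffineAveraging (box toSite)
open AveragingContoursRooted (ctrOff ctrOff_mem_box)
open BalabanCompositeJets (LocStencil₂)
open BalabanStepW2 (locStencil₂_add' locStencil₂_smul')
open SecondOrderResponse (LocStencilFM)
open PolarizationSign (reflSign)
open KernelReflection (refK)
open ResolventReflection (bref Φ)
open Summit.QuantumFields.BalabanUV.Beta.TameKernelCalculus (trK)
open Summit.QuantumFields.BalabanUV.Beta.ChartConjugation (conjW)
open Summit.QuantumFields.BalabanUV.Beta.BorderedHessian (diagK sgnK ctGen bhKStepAt stepScale spr_bhKStepAt)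
open Summit.QuantumFields.BalabanUV.Beta.HessKerDressedUnits (legScale legScale_inl)
open Summit.QuantumFields.BalabanUV.Beta.SecondOrderUnits (unitS₂)
open Summit.QuantumFields.BalabanUV.Beta.SpineRooted (SpureRecAt T2RecAt locStencil_SpureRecAt T2RecAt_loc T2RecAt_translate)
open Summit.QuantumFields.BalabanUV.Beta.SecondOrderBorderClassKit (locStencil₂_conjW)
open Summit.QuantumFields.BalabanUV.Beta.SpineRecursivePureParity (locStencil_diagK_smul_ctGen)
open Summit.QuantumFields.BalabanUV.Beta.SecondOrderZeroCanon (locStencil₂_diagK_ctGen_mul_ctGen)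
open Summit.QuantumFields.BalabanUV.Beta.GAN24.BiStencilZeroMode (Tab zmode)
open Summit.QuantumFields.BalabanUV.Beta.GAN24.WSlotFirstDiff (zmode_add)
open Summit.QuantumFields.BalabanUV.Beta.GAN24.T2SlotUnits (unitS₂_apply)
open Summit.QuantumFields.BalabanUV.Beta.GAN24.ZeroModeReflectionParity (two_mul_zmode_eq_neg_of_reflSign_prod zmode_inl_inl_add_legSwap_eq_zero_of_parityOdd
  reflSign_prod_eq_neg_one_iff)
open Summit.QuantumFields.BalabanUV.Beta.GAN24.CombQuarticContactChargeZero (zmode_conjW_comb_eq_zero)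

namespace Summit.QuantumFields.BalabanUV.Beta.GAN24.CombChargeParityOddOfQuarticLaw

variable {d : ℕ}

/-! ## §1 Generic: a defect with leg-antisymmetric charge forces leg-antisymmetric charge on the odd patterns of its axis -/

section Generic

variable {N : ℕ} [NeZero N] {T J : Tab d} {CT CJ δ : ℝ}

/-- NOT IN PRINT; OUR BOOKKEEPING.  **LEG-ANTISYMMETRY ON THE ODD PATTERNS OF THE AXIS** (see the module docstring, §1). -/
theorem zmode_add_legSwap_eq_zero_of_refl_add (α : Fin (d + 1))
    (hT : ∀ (κ : Fin (d + 1)) (u : Fin (d + 1) → ℤ) (κ' : Fin (d + 1)) (u' t : Fin (d + 1) → ℤ),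
      T κ (u + (N : ℤ) • t) κ' (u' + (N : ℤ) • t) = shiftK (-((N : ℤ) • t)) (T κ u κ' u'))
    (hR : ∀ (κ : Fin (d + 1)) (u : Fin (d + 1) → ℤ) (κ' : Fin (d + 1)) (u' : Fin (d + 1) → ℤ),
      T κ (bref α κ u) κ' (bref α κ' u') = (reflSign α κ * reflSign α κ') • refK (Φ N α) (T κ u κ' u' + J κ u κ' u'))
    (hTc : LocStencil₂ T CT δ) (hJc : LocStencil₂ J CJ δ) (hδ : 0 < δ) {κ κ' κ₁ κ₂ : Fin (d + 1)}
    (hJ : zmode N J κ κ' (Sum.inl κ₁) (Sum.inl κ₂) + zmode N J κ κ' (Sum.inl κ₂) (Sum.inl κ₁) = 0)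
    (hodd : reflSign α κ * reflSign α κ' * reflSign α κ₁ * reflSign α κ₂ = -1) :
    zmode N T κ κ' (Sum.inl κ₁) (Sum.inl κ₂) + zmode N T κ κ' (Sum.inl κ₂) (Sum.inl κ₁) = 0 := by
  have hodd' : reflSign α κ * reflSign α κ' * reflSign α κ₂ * reflSign α κ₁ = -1 := by
    rw [← hodd]; ring
  have h12 := two_mul_zmode_eq_neg_of_reflSign_prod α hT hR hodd
  have h21 := two_mul_zmode_eq_neg_of_reflSign_prod α hT hR hodd'
  rw [zmode_add (N := N) hTc hJc hδ] at h12 h21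
  linarith

variable {JW R : Tab d} {CW CR : ℝ}

omit [NeZero N] in
/-- NOT IN PRINT; OUR BOOKKEEPING.  **A SPLIT DEFECT**: `J = J^W + R` with `J^W` of zero ff charge at both leg orders and `R` row-parity-odd (`trK R = −sgnK R`, both
`LocStencil₂`) has leg-antisymmetric ff charge (g47 `zmode_inl_inl_add_legSwap_eq_zero_of_parityOdd`). -/
theorem legAntisym_of_split (hWc : LocStencil₂ JW CW δ) (hRc : LocStencil₂ R CR δ) (hδ : 0 < δ)
    (hRp : ∀ (κ : Fin (d + 1)) (u : Fin (d + 1) → ℤ) (κ' : Fin (d + 1)) (u' : Fin (d + 1) → ℤ), trK (R κ u κ' u') = -sgnK (R κ u κ' u'))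
    {κ κ' κ₁ κ₂ : Fin (d + 1)} (hW12 : zmode N JW κ κ' (Sum.inl κ₁) (Sum.inl κ₂) = 0) (hW21 : zmode N JW κ κ' (Sum.inl κ₂) (Sum.inl κ₁) = 0) :
    zmode N (fun κ u κ' u' => JW κ u κ' u' + R κ u κ' u') κ κ' (Sum.inl κ₁) (Sum.inl κ₂)
      + zmode N (fun κ u κ' u' => JW κ u κ' u' + R κ u κ' u') κ κ' (Sum.inl κ₂) (Sum.inl κ₁) = 0 := by
  rw [zmode_add (N := N) hWc hRc hδ, zmode_add (N := N) hWc hRc hδ, hW12, hW21, zero_add, zero_add]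
  exact zmode_inl_inl_add_legSwap_eq_zero_of_parityOdd (N := N) hRc hδ hRp κ κ' κ₁ κ₂

end Generic

/-! ## §2 The comb tower at level `j`: leg-antisymmetric charge on the odd patterns, GIVEN the quartic table law -/

section Comb

variable {Lc : ℕ} [NeZero Lc]

/-- NOT IN PRINT; OUR BOOKKEEPING.  **THE COMB MEMBER's ff CHARGE IS LEG-ANTISYMMETRIC ON EVERY PATTERN WITH AN ODD AXIS — GIVEN THE QUARTIC TABLE LAW AT LEVEL `j`**
(WANTED W-an2-1 as the hypothesis `hlaw`, in the shape of an2's `T2RecAt_bref_all_of_letters` with the canonical second symbol; see the module docstring, §2). -/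
theorem zmode_T2RecAt_add_legSwap_eq_zero_of_law (hLc : Odd Lc) (cΛ cE₂ cB : ℝ) (Tc : Fin 4 → Fin 4 → Fin 4 → Fin 4 → ℝ)
    {vh₂S : Fin 4 → (Fin 4 → ℤ) → Fin 4 → (Fin 4 → ℤ) → MKer 4 (Fib 3)} (hB : ∃ C δ : ℝ, 0 < δ ∧ LocStencil₂ vh₂S C δ)
    (hBt : ∀ (κ : Fin 4) (u : Fin 4 → ℤ) (κ' : Fin 4) (u' t : Fin 4 → ℤ), vh₂S κ (u + (Lc : ℤ) • t) κ' (u' + (Lc : ℤ) • t) = shiftK (-((Lc : ℤ) • t)) (vh₂S κ u κ' u'))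
    {mixFF : Fin 4 → (Fin 4 → ℤ) → Fin 4 → (Fin 4 → ℤ) → MKer 4 (Fib 3)} (hmix : ∃ C δ : ℝ, 0 < δ ∧ LocStencilFM Lc mixFF C δ)
    (hmixt : ∀ (κ : Fin 4) (u : Fin 4 → ℤ) (μ : Fin 4) (w t : Fin 4 → ℤ), mixFF κ (u + (Lc : ℤ) • t) μ (w + t) = shiftK (-((Lc : ℤ) • t)) (mixFF κ u μ w))
    (j : ℕ) (γ γ₂ : ℝ) (R2 : Fin 4 → Fin 4 → (Fin 4 → ℤ) → Fin 4 → (Fin 4 → ℤ) → MKer 4 (Fib 3))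
    (hR2c : ∀ α : Fin 4, ∃ C δ : ℝ, 0 < δ ∧ LocStencil₂ (R2 α) C δ)
    (hR2p : ∀ (α : Fin 4) κ u κ' u', trK (R2 α κ u κ' u') = -sgnK (R2 α κ u κ' u'))
    (hlaw : ∀ (α κ : Fin 4) (u : Fin 4 → ℤ) (κ' : Fin 4) (u' : Fin 4 → ℤ),
      T2RecAt 3 Lc (toSite (ctrOff 4 Lc)) ((Lc : ℝ) ^ 4) (-((Lc : ℝ) ^ 8 / 2)) cΛ cE₂ cB Tc vh₂S mixFF j κ (bref α κ u) κ' (bref α κ' u') =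
        (reflSign α κ * reflSign α κ') • refK (Φ Lc α)
          (T2RecAt 3 Lc (toSite (ctrOff 4 Lc)) ((Lc : ℝ) ^ 4) (-((Lc : ℝ) ^ 8 / 2)) cΛ cE₂ cB Tc vh₂S mixFF j κ u κ' u' +
            conjW (bhKStepAt 3 (toSite (ctrOff 4 Lc)) Lc j)
              (SpureRecAt 3 Lc (toSite (ctrOff 4 Lc)) ((Lc : ℝ) ^ 4) (-((Lc : ℝ) ^ 8 / 2)) cΛ j κ u)
              (SpureRecAt 3 Lc (toSite (ctrOff 4 Lc)) ((Lc : ℝ) ^ 4) (-((Lc : ℝ) ^ 8 / 2)) cΛ j κ' u')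
              (diagK fun p a => γ * ctGen 3 α Lc κ u p a) (diagK fun p a => γ * ctGen 3 α Lc κ' u' p a)
              (diagK fun p a => γ₂ * (ctGen 3 α Lc κ u p a * ctGen 3 α Lc κ' u' p a)) +
            R2 α κ u κ' u'))
    {κ κ' κ₁ κ₂ : Fin 4} (hodd : ∃ α : Fin 4, reflSign α κ * reflSign α κ' * reflSign α κ₁ * reflSign α κ₂ = -1) :
    zmode Lc (T2RecAt 3 Lc (toSite (ctrOff 4 Lc)) ((Lc : ℝ) ^ 4) (-((Lc : ℝ) ^ 8 / 2)) cΛ cE₂ cB Tc vh₂S mixFF j) κ κ' (Sum.inl κ₁) (Sum.inl κ₂)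
      + zmode Lc (T2RecAt 3 Lc (toSite (ctrOff 4 Lc)) ((Lc : ℝ) ^ 4) (-((Lc : ℝ) ^ 8 / 2)) cΛ cE₂ cB Tc vh₂S mixFF j) κ κ' (Sum.inl κ₂) (Sum.inl κ₁) = 0 := by
  classical
  obtain ⟨α, hα⟩ := hodd
  have hL1 : 1 ≤ Lc := hLc.pos
  have hr := ctrOff_mem_box (d := 4) hL1
  -- classes of the member, the contact defect and the remainder at ONE common rate
  obtain ⟨CT, δT, hδT, hTc⟩ := T2RecAt_loc ((Lc : ℝ) ^ 4) (-((Lc : ℝ) ^ 8 / 2)) cΛ cE₂ cB Tc vh₂S mixFF hL1 hr hB hmix j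
  obtain ⟨Cs, δs, hδs, hS⟩ := locStencil_SpureRecAt (d := 3) (Lc := Lc) hL1 hr ((Lc : ℝ) ^ 4) (-((Lc : ℝ) ^ 8 / 2)) cΛ j
  obtain ⟨C𝕄, δ𝕄, hδ𝕄, h𝕄⟩ := spr_bhKStepAt (d := 3) (Lc := Lc) hr j
  obtain ⟨CR, δR, hδR, hRc⟩ := hR2c α
  set δ : ℝ := min (min δT δs) (min δ𝕄 δR) with hδdef
  have hδ : 0 < δ := lt_min (lt_min hδT hδs) (lt_min hδ𝕄 hδR)
  have hδT' : δ ≤ δT := (min_le_left _ _).trans (min_le_left _ _)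
  have hδs' : δ ≤ δs := (min_le_left _ _).trans (min_le_right _ _)
  have hδ𝕄' : δ ≤ δ𝕄 := (min_le_right _ _).trans (min_le_left _ _)
  have hδR' : δ ≤ δR := (min_le_right _ _).trans (min_le_right _ _)
  have hCs : 0 ≤ Cs := (hS 0 0).nonneg (Sum.inl 0)
  have hC𝕄 : 0 ≤ C𝕄 := h𝕄.nonneg (Sum.inl 0)
  have hTc' := hTc.mono hδT'
  have hRc' := hRc.mono hδR'
  have hS' : LocStencil (SpureRecAt 3 Lc (toSite (ctrOff 4 Lc)) ((Lc : ℝ) ^ 4) (-((Lc : ℝ) ^ 8 / 2)) cΛ j) Cs δ := locStencil_mono hS hCs hδs'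
  have h𝕄' : Decays (bhKStepAt 3 (toSite (ctrOff 4 Lc)) Lc j) C𝕄 δ := decays_mono h𝕄 hC𝕄 le_rfl hδ𝕄'
  have hX := locStencil_diagK_smul_ctGen (d := 3) (Lc := Lc) γ α hδ.le
  have hX₂ := locStencil₂_diagK_ctGen_mul_ctGen (d := 3) α Lc γ₂ hδ.le
  obtain ⟨CW, hWc⟩ := locStencil₂_conjW h𝕄' hS' hX hX₂ hδ
  -- common rate δ/8 for everybody
  have h8 : δ / 8 ≤ δ := by linarith
  have hδ8 : 0 < δ / 8 := by positivity
  have hTc8 := hTc'.mono h8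
  have hRc8 := hRc'.mono h8
  -- the defect's leg-antisymmetric charge: contact part zero (both leg orders), remainder parity-odd
  have hJ := legAntisym_of_split (N := Lc) hWc hRc8 hδ8 (hR2p α)
    (zmode_conjW_comb_eq_zero hLc cΛ γ γ₂ j α κ κ' κ₁ κ₂) (zmode_conjW_comb_eq_zero hLc cΛ γ γ₂ j α κ κ' κ₂ κ₁)
  have hJc := locStencil₂_add' hWc hRc8
  exact zmode_add_legSwap_eq_zero_of_refl_add (N := Lc) α
    (T2RecAt_translate (toSite (ctrOff 4 Lc)) ((Lc : ℝ) ^ 4) (-((Lc : ℝ) ^ 8 / 2)) cΛ cE₂ cB Tc vh₂S mixFF hL1 hBt hmixt j)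
    (fun κ u κ' u' => by rw [hlaw α κ u κ' u', add_assoc]) hTc8 hJc hδ8 hJ hα

/-! ## §3 The member in step units -/

/-- [folklore] On the ff block the change of units is a scalar: `unitS₂ sf sm T κ u κ′ u′ x z (inl a) (inl b) = ((sf sm)⁻¹·(sf sm)⁻¹·sf⁻¹·sf⁻¹)·T κ u κ′ u′ x z (inl a) (inl b)`. -/
theorem unitS₂_inl_inl (sf sm : ℝ) (T : Tab d) (κ : Fin (d + 1)) (u : Fin (d + 1) → ℤ) (κ' : Fin (d + 1)) (u' x z : Fin (d + 1) → ℤ) (a b : Fin (d + 1)) :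
    unitS₂ sf sm T κ u κ' u' x z (Sum.inl a) (Sum.inl b) = ((sf * sm)⁻¹ * (sf * sm)⁻¹ * (sf⁻¹ * sf⁻¹)) * T κ u κ' u' x z (Sum.inl a) (Sum.inl b) := by
  rw [unitS₂_apply, legScale_inl, legScale_inl]
  ring

/-- [folklore] Hence the ff charge rescales: `zmode N (unitS₂ sf sm T) κ κ′ (inl κ₁) (inl κ₂) = c · zmode N T κ κ′ (inl κ₁) (inl κ₂)`. -/
theorem zmode_unitS₂_inl_inl {N : ℕ} (sf sm : ℝ) (T : Tab d) (κ κ' κ₁ κ₂ : Fin (d + 1)) :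
    zmode N (unitS₂ sf sm T) κ κ' (Sum.inl κ₁) (Sum.inl κ₂) = ((sf * sm)⁻¹ * (sf * sm)⁻¹ * (sf⁻¹ * sf⁻¹)) * zmode N T κ κ' (Sum.inl κ₁) (Sum.inl κ₂) := by
  simp only [zmode, unitS₂_inl_inl, tsum_mul_left, Finset.mul_sum]

/-- NOT IN PRINT; OUR BOOKKEEPING.  **THE SAME FOR THE MEMBER IN STEP UNITS** `unitS₂ sf sm (T2RecAt … j)` (any units `sf sm`; the literal's `T̃_j` has `sf = sfStep Lc j`,
`sm = smStep 3 Lc j`): leg-antisymmetric ff charge on every pattern with an odd axis, GIVEN the quartic table law at level `j`. -/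
theorem zmode_unitS₂_T2RecAt_add_legSwap_eq_zero_of_law (hLc : Odd Lc) (cΛ cE₂ cB : ℝ) (Tc : Fin 4 → Fin 4 → Fin 4 → Fin 4 → ℝ)
    {vh₂S : Fin 4 → (Fin 4 → ℤ) → Fin 4 → (Fin 4 → ℤ) → MKer 4 (Fib 3)} (hB : ∃ C δ : ℝ, 0 < δ ∧ LocStencil₂ vh₂S C δ)
    (hBt : ∀ (κ : Fin 4) (u : Fin 4 → ℤ) (κ' : Fin 4) (u' t : Fin 4 → ℤ), vh₂S κ (u + (Lc : ℤ) • t) κ' (u' + (Lc : ℤ) • t) = shiftK (-((Lc : ℤ) • t)) (vh₂S κ u κ' u'))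
    {mixFF : Fin 4 → (Fin 4 → ℤ) → Fin 4 → (Fin 4 → ℤ) → MKer 4 (Fib 3)} (hmix : ∃ C δ : ℝ, 0 < δ ∧ LocStencilFM Lc mixFF C δ)
    (hmixt : ∀ (κ : Fin 4) (u : Fin 4 → ℤ) (μ : Fin 4) (w t : Fin 4 → ℤ), mixFF κ (u + (Lc : ℤ) • t) μ (w + t) = shiftK (-((Lc : ℤ) • t)) (mixFF κ u μ w))
    (j : ℕ) (γ γ₂ : ℝ) (R2 : Fin 4 → Fin 4 → (Fin 4 → ℤ) → Fin 4 → (Fin 4 → ℤ) → MKer 4 (Fib 3))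
    (hR2c : ∀ α : Fin 4, ∃ C δ : ℝ, 0 < δ ∧ LocStencil₂ (R2 α) C δ)
    (hR2p : ∀ (α : Fin 4) κ u κ' u', trK (R2 α κ u κ' u') = -sgnK (R2 α κ u κ' u'))
    (hlaw : ∀ (α κ : Fin 4) (u : Fin 4 → ℤ) (κ' : Fin 4) (u' : Fin 4 → ℤ),
      T2RecAt 3 Lc (toSite (ctrOff 4 Lc)) ((Lc : ℝ) ^ 4) (-((Lc : ℝ) ^ 8 / 2)) cΛ cE₂ cB Tc vh₂S mixFF j κ (bref α κ u) κ' (bref α κ' u') =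
        (reflSign α κ * reflSign α κ') • refK (Φ Lc α)
          (T2RecAt 3 Lc (toSite (ctrOff 4 Lc)) ((Lc : ℝ) ^ 4) (-((Lc : ℝ) ^ 8 / 2)) cΛ cE₂ cB Tc vh₂S mixFF j κ u κ' u' +
            conjW (bhKStepAt 3 (toSite (ctrOff 4 Lc)) Lc j)
              (SpureRecAt 3 Lc (toSite (ctrOff 4 Lc)) ((Lc : ℝ) ^ 4) (-((Lc : ℝ) ^ 8 / 2)) cΛ j κ u)
              (SpureRecAt 3 Lc (toSite (ctrOff 4 Lc)) ((Lc : ℝ) ^ 4) (-((Lc : ℝ) ^ 8 / 2)) cΛ j κ' u')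
              (diagK fun p a => γ * ctGen 3 α Lc κ u p a) (diagK fun p a => γ * ctGen 3 α Lc κ' u' p a)
              (diagK fun p a => γ₂ * (ctGen 3 α Lc κ u p a * ctGen 3 α Lc κ' u' p a)) +
            R2 α κ u κ' u'))
    (sf sm : ℝ) {κ κ' κ₁ κ₂ : Fin 4} (hodd : ∃ α : Fin 4, reflSign α κ * reflSign α κ' * reflSign α κ₁ * reflSign α κ₂ = -1) :
    zmode Lc (unitS₂ sf sm (T2RecAt 3 Lc (toSite (ctrOff 4 Lc)) ((Lc : ℝ) ^ 4) (-((Lc : ℝ) ^ 8 / 2)) cΛ cE₂ cB Tc vh₂S mixFF j)) κ κ' (Sum.inl κ₁) (Sum.inl κ₂)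
      + zmode Lc (unitS₂ sf sm (T2RecAt 3 Lc (toSite (ctrOff 4 Lc)) ((Lc : ℝ) ^ 4) (-((Lc : ℝ) ^ 8 / 2)) cΛ cE₂ cB Tc vh₂S mixFF j)) κ κ' (Sum.inl κ₂) (Sum.inl κ₁)
        = 0 := by
  rw [zmode_unitS₂_inl_inl, zmode_unitS₂_inl_inl, ← mul_add,
    zmode_T2RecAt_add_legSwap_eq_zero_of_law hLc cΛ cE₂ cB Tc hB hBt hmix hmixt j γ γ₂ R2 hR2c hR2p hlaw hodd, mul_zero]

/-- [folklore] **THE ODD-AXIS PATTERNS, COUNTED** (g47 `reflSign_prod_eq_neg_one_iff`): a pattern `(κ, κ′; κ₁, κ₂)` has an axis of odd multiplicity iff it is NOT of the form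
«every direction occurs an even number of times» — at `d + 1 = 4` these are 216 of the 256 patterns (all but the 36 two-pair and 4 all-equal ones).  Stated as the
criterion used above: `(∃ α, ε_κ ε_κ′ ε_κ₁ ε_κ₂ = −1) ↔ ∃ α, Odd (#occurrences of α)`. -/
theorem exists_odd_axis_iff (κ κ' κ₁ κ₂ : Fin (d + 1)) :
    (∃ α : Fin (d + 1), reflSign α κ * reflSign α κ' * reflSign α κ₁ * reflSign α κ₂ = -1) ↔
      ∃ α : Fin (d + 1), Odd ((if κ = α then 1 else 0) + (if κ' = α then 1 else 0) + (if κ₁ = α then 1 else 0) + (if κ₂ = α then 1 else 0) : ℕ) := by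
  simp only [reflSign_prod_eq_neg_one_iff]

end Comb

end Summit.QuantumFields.BalabanUV.Beta.GAN24.CombChargeParityOddOfQuarticLaw

end
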